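import Summits.BirchSwinnertonDyer.BirchSwinnertonDyer.Theorems.ByReductionTypeAtTwoFineSelmerConjAAtTwoAdditivePotGoodClassNumberOddCriterion
import Summits.BirchSwinnertonDyer.BirchSwinnertonDyer.Theorems.ByReductionTypeAtTwoFineSelmerConjAAtTwoAdditivePotGoodCensusDoorStampsB
import HarnessLib

/-!
# Route `ByReductionTypeAtTwo` (rung K4), crux C1″ `FineSelmerConjAAtTwoAdditivePotGood` (item stmt-BirchSwinnertonDyer-22615):
# ODD CLASS NUMBER (h = 3 IN THE CENSUS) FOR THE CUBIC FIELD OF DISCRIMINANT `−2695` (`X³ + (0)X² + (7)X + (-7)`, index `1`) BY A NORM CERTIFICATE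
# (KERNEL) — the `2`-torsion point field `ℚ(P)` of the census row `474320im1`, whose census stamp thereby needs NO displayed datum any more ((A)₂ modulo Lim 2017 Thm. 3.5 ALONE)
# (a `--supports 22615` file; seat `bsd-2adic-k4-w1` GEN 6; consumer of `…ClassNumberOneCriterion` / `…ClassNumberOneCriterionFrac`)

HONEST FRAMING (cell `bsd-2adic`, D-0036/D-0054): §1 UNCONDITIONAL kernel arithmetic; §2 conditional on `hLim2` (Lim 2017 Thm. 3.5 at `2`) BY NAME
and NOTHING ELSE; closes nothing at the `∀`-level; nothing booked; BSD is not proved by any of this.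

THE CERTIFICATE (generated by the seat's exact-arithmetic tools — reduced model, integral basis, relation sieve with Dedekind–Kummer
bookkeeping, unit reduction — and CHECKED HERE by the kernel): `g = X³ + (0)X² + (7)X + (-7)`, `disc g = 2695 = 1² · (-2695)`;
`M_K < 15`.
For every prime `ℓ < 15` and every root `a` of `g mod ℓ` the proof lists a generator `(x + yθ + zθ²)/m` of the ideals `I ∋ ℓ, θ − a` of norm `ℓ`
(6 witnesses, 0 of them outside `ℤ[θ]`, 5 of them CUBE witnesses (I³ = (ω), with Bézout identity and lift)). No Dedekind–Kummer theory is invoked in the proof: the criterion only uses `𝓞/I ≅ 𝔽_ℓ`.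

References: [Marcus1977] Ch. 2 Exercise 27, Ch. 5 Thm. 35–37; [Cohen1993] §4.8.2, §6.3; [Lim2017FineSelmer] Thm. 3.5, Lemma 3.2;
[Greenberg2001IwasawaPastPresent] Prop. 2.1 (Iwasawa 1956); [Fukuda1994] Thm. 1 (1).
-/

set_option autoImplicit false
-- sibling precedent (`…ClassNumberOneCriterionFrac.lean`): the directory name repeats the summit name
set_option linter.dupNamespace false

noncomputable section

open scoped Classical IntermediateField NumberField Real nonZeroDivisors

namespace Summit.BirchSwinnertonDyer.BirchSwinnertonDyer.Theorems.AddKatoTwo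

open WeierstrassCurve Field Polynomial IsDedekindDomain NumberField Matrix Literature.NumberTheory.EllipticCurves
  Literature.NumberTheory.GaloisRepresentations
  Literature.NumberTheory.IwasawaTheory
  Summit.BirchSwinnertonDyer.BirchSwinnertonDyer.Theorems.AlignedTransportAtTwoTorsionPointField
  Summit.BirchSwinnertonDyer.BirchSwinnertonDyer.Theses.ByReductionTypeAtTwo

/-! ## §1 The certificate: `h` odd for the field of `X³ + (0)X² + (7)X + (-7)` -/

section Certificate

variable (K : Type) [Field K] [NumberField K]

/-- `X³ + (0)X² + (7)X + (-7)` is irreducible over `ℚ` (no root mod `2`). -/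
theorem irreducible_cubic_d2695n : Irreducible (Cubic.toPoly ⟨1, ((0 : ℤ) : ℚ), ((7 : ℤ) : ℚ), ((-7 : ℤ) : ℚ)⟩) :=
  haveI : Fact (Nat.Prime 2) := ⟨by norm_num⟩
  irreducible_cubic_of_no_root_zmod 2 (by decide)

/-- **`h` is ODD for every cubic number field whose integers contain a root `θ` of `X³ + (0)X² + (7)X + (-7)`** (`|disc| = 2695`, index
`1`, `M_K < 15`): a norm certificate — for every prime `ℓ < 15` and every root `a` of the cubic mod `ℓ` a generator
of the CUBE (or of the ideal itself) `(x + yθ + zθ²)/m ∈ 𝓞 K` of every ideal `I ∋ ℓ, θ − a` of norm `ℓ` (listed in the proof; `m > 1` = element of `𝓞 K ∖ ℤ[θ]`, certified by its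
scaled cubic identity). KERNEL.
[cite: Marcus1977, Ch. 5 Thm. 37 and Cor. 2] [cite: Cohen1993, §6.3] -/
theorem odd_classNumber_of_root_d2695n (h3 : Module.finrank ℚ K = 3) (b : 𝓞 K)
    (hb : b ^ 3 + (0 : ℤ) * b ^ 2 + (7 : ℤ) * b + (-7 : ℤ) = 0) : Odd (NumberField.classNumber K) := by
  have hirr := irreducible_cubic_d2695n
  have hd : |NumberField.discr K| ≤ (2695 : ℕ) :=
    (abs_discr_le_abs_cubic_discr K h3 b hirr hb).trans (by simp only [Cubic.discr]; norm_num)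
  refine odd_classNumber_of_cubeCertificate K h3 (B := 15)
    (minkowskiBound_lt_of_sqrt_le K h3 hd (s := 51.92)
      ((Real.sqrt_le_sqrt (by norm_num : ((2695 : ℕ) : ℝ) ≤ (51.92 : ℝ) ^ 2)).trans (Real.sqrt_sq (by norm_num)).le)
      (by norm_num)) ?_
  intro ℓ hℓB hℓ J hJ
  interval_cases ℓ <;> norm_num at hℓ
  · -- `ℓ = 2`: roots none
    refine pow_three_eq_span_of_cert K h3 b hirr hb (by norm_num) (fun a ha hdvd => ?_) hJ
    interval_cases a <;> norm_num at hdvd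
  · -- `ℓ = 3`: roots [2]
    refine pow_three_eq_span_of_cert K h3 b hirr hb (by norm_num) (fun a ha hdvd => ?_) hJ
    interval_cases a <;> norm_num at hdvd
    · exact Or.inr ⟨1, (-2), 0, 1, by norm_num, by norm_num, ⟨_, by rw [Nat.cast_one, one_mul]⟩, by norm_num,
        ⟨1, 1, 0, 0, 1, (-1), 0, by push_cast; linear_combination ((0 : 𝓞 K)) * hb⟩, ⟨0, by norm_num⟩⟩
  · -- `ℓ = 5`: roots [2, 4]
    refine pow_three_eq_span_of_cert K h3 b hirr hb (by norm_num) (fun a ha hdvd => ?_) hJ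
    interval_cases a <;> norm_num at hdvd
    · exact Or.inr ⟨(-1), 3, 0, 1, by norm_num, by norm_num, ⟨_, by rw [Nat.cast_one, one_mul]⟩, by norm_num,
        ⟨1, 2, 0, 0, 0, 1, 0, by push_cast; linear_combination ((0 : 𝓞 K)) * hb⟩, ⟨0, by norm_num⟩⟩
    · exact Or.inr ⟨(-1), 3, (-1), 1, by norm_num, by norm_num, ⟨_, by rw [Nat.cast_one, one_mul]⟩, by norm_num,
        ⟨2, 4, 0, 0, (-4), 4, (-1), by push_cast; linear_combination ((0 : 𝓞 K)) * hb⟩, ⟨0, by norm_num⟩⟩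
  · -- `ℓ = 7`: roots [0]
    refine pow_three_eq_span_of_cert K h3 b hirr hb (by norm_num) (fun a ha hdvd => ?_) hJ
    interval_cases a <;> norm_num at hdvd
    · exact Or.inl ⟨0, (-1), 0, 1, by norm_num, by norm_num, ⟨_, by rw [Nat.cast_one, one_mul]⟩, by norm_num⟩
  · -- `ℓ = 11`: roots [7, 8]
    refine pow_three_eq_span_of_cert K h3 b hirr hb (by norm_num) (fun a ha hdvd => ?_) hJ
    interval_cases a <;> norm_num at hdvd
    · exact Or.inr ⟨(-6), 8, 1, 1, by norm_num, by norm_num, ⟨_, by rw [Nat.cast_one, one_mul]⟩, by norm_num,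
        ⟨2, 1, 0, 0, (-5), 2, 0, by push_cast; linear_combination ((0 : 𝓞 K)) * hb⟩, ⟨0, by norm_num⟩⟩
    · exact Or.inr ⟨(-8), 4, 1, 1, by norm_num, by norm_num, ⟨_, by rw [Nat.cast_one, one_mul]⟩, by norm_num,
        ⟨1, 9, 6, 0, (-2), (-5), 3, by push_cast; linear_combination ((6 : 𝓞 K)) * hb⟩, ⟨0, by norm_num⟩⟩
  · -- `ℓ = 13`: roots none
    refine pow_three_eq_span_of_cert K h3 b hirr hb (by norm_num) (fun a ha hdvd => ?_) hJ
    interval_cases a <;> norm_num at hdvd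

end Certificate

/-! ## §2 The census row `474320im1` -/

/-- **(A)₂ for the census curve `474320im1` modulo Lim 2017 Thm. 3.5 ALONE — NO displayed datum.** Its `2`-torsion cubic field
(`d = -2695`) has ODD `h` (census: `h = 3`) BY THE KERNEL (`odd_classNumber_of_root_d2695n`): the element
`θ = 464937170/1500512167 + (159657/1500512167)·β + (1/1500512167)·β²` of `ℚ(β)` (`β` a root of the `2`-division cubic) is a root of `X³ + (0)X² + (7)X + (-7)` and
`β = -2515 + (9240)·θ + (-539)·θ²`, so `ℚ(P) = ℚ(β) = ℚ(θ)` (identities = `linear_combination`s of the `2`-division relation; coefficients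
found by exact linear algebra in `ℚ[X]/(G)`). UPGRADES `conjA_two_474320im1_of_oddClassNumber`. [cite: Lim2017FineSelmer, §3 Thm. 3.5 and Lemma 3.2]
[cite: Greenberg2001IwasawaPastPresent, Prop. 2.1 p. 339] [cite: Cohen1993, §6.3] -/
theorem conjA_two_474320im1
    (hLim2 : Lim2017.thm35_at_two_fineSelmerDual_moduleFinite_of_classicalMuVanishes_of_le_divisionField_four)
    (κ : ZpExtension ℚ 2) (hκ : κ.IsCyclotomic) :
    haveI := isElliptic_474320im1'
    ∃ (γ : absoluteGaloisGroup ℚ) (D : (⟨0, ((-1 : ℤ) : ℚ), 0, ((697485584 : ℤ) : ℚ), ((-3875995995969 : ℤ) : ℚ)⟩ : WeierstrassCurve ℚ).FineSelmerDualData κ γ),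
      Module.Finite ℤ_[2] (RestrictScalars ℤ_[2] (IwasawaAlgebra 2) D.X) := by
  haveI := isElliptic_474320im1'
  obtain ⟨β, hβ⟩ : ∃ β : AlgebraicClosure ℚ, aeval β (Cubic.toPoly ⟨1, ((-1 : ℤ) : ℚ), ((697485584 : ℤ) : ℚ), ((-3875995995969 : ℤ) : ℚ)⟩) = 0 :=
    IsAlgClosed.exists_aeval_eq_zero _ _ (by rw [Cubic.degree_of_a_ne_zero one_ne_zero]; norm_num)
  have hβ' : β ^ 3 + (-1 : AlgebraicClosure ℚ) * β ^ 2 + (697485584 : AlgebraicClosure ℚ) * β + (-3875995995969 : AlgebraicClosure ℚ) = 0 := by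
    have := hβ
    simp only [Cubic.toPoly, map_one, one_mul, aeval_add, aeval_mul, aeval_C, aeval_X_pow, aeval_X,
      eq_ratCast, Rat.cast_intCast] at this
    push_cast at this
    linear_combination this
  set θ : AlgebraicClosure ℚ := algebraMap ℚ (AlgebraicClosure ℚ) (464937170 / 1500512167 : ℚ) +
      algebraMap ℚ (AlgebraicClosure ℚ) (159657 / 1500512167 : ℚ) * β + algebraMap ℚ (AlgebraicClosure ℚ) (1 / 1500512167 : ℚ) * β ^ 2 with hθdef
  have hθ : aeval θ (Cubic.toPoly ⟨1, ((0 : ℤ) : ℚ), ((7 : ℤ) : ℚ), ((-7 : ℤ) : ℚ)⟩) = 0 := by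
    simp only [Cubic.toPoly, map_one, one_mul, aeval_add, aeval_mul, aeval_C, aeval_X_pow, aeval_X, eq_ratCast,
      Rat.cast_intCast]
    rw [hθdef]
    simp only [eq_ratCast]
    push_cast
    linear_combination (((4184973973404699 : AlgebraicClosure ℚ) / 3378458307802010605486161463) + ((77168877845 : AlgebraicClosure ℚ) / 3378458307802010605486161463) * β + ((478972 : AlgebraicClosure ℚ) / 3378458307802010605486161463) * β ^ 2 + ((1 : AlgebraicClosure ℚ) / 3378458307802010605486161463) * β ^ 3) * hβ'
  have hadj : IntermediateField.adjoin ℚ {θ} = IntermediateField.adjoin ℚ {β} := by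
    apply le_antisymm
    · rw [IntermediateField.adjoin_simple_le_iff, hθdef]
      have hβmem := IntermediateField.mem_adjoin_simple_self ℚ β
      exact add_mem (add_mem (algebraMap_mem _ _) (mul_mem (algebraMap_mem _ _) hβmem))
        (mul_mem (algebraMap_mem _ _) (pow_mem hβmem 2))
    · rw [IntermediateField.adjoin_simple_le_iff]
      have hβeq : β = algebraMap ℚ (AlgebraicClosure ℚ) (-2515 : ℚ) + algebraMap ℚ (AlgebraicClosure ℚ) (9240 : ℚ) * θ +
          algebraMap ℚ (AlgebraicClosure ℚ) (-539 : ℚ) * θ ^ 2 := by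
        rw [hθdef]; simp only [eq_ratCast]; push_cast; linear_combination (((319315 : AlgebraicClosure ℚ) / 4177248169415651) + ((1 : AlgebraicClosure ℚ) / 4177248169415651) * β) * hβ'
      rw [hβeq]
      have hθmem := IntermediateField.mem_adjoin_simple_self ℚ θ
      exact add_mem (add_mem (algebraMap_mem _ _) (mul_mem (algebraMap_mem _ _) hθmem))
        (mul_mem (algebraMap_mem _ _) (pow_mem hθmem 2))
  refine conjA_two_474320im1_of_oddClassNumber hLim2 hβ ?_ κ hκ
  rw [← hadj]
  exact not_two_dvd_card_classGroup_adjoin_of_forall_cubicField_odd irreducible_cubic_d2695n (odd_classNumber_of_root_d2695n) hθ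

end Summit.BirchSwinnertonDyer.BirchSwinnertonDyer.Theorems.AddKatoTwo

end
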